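import Summits.BirchSwinnertonDyer.BirchSwinnertonDyer.Theorems.PublishedInputsAdditiveKolyOfSeven
import Summits.BirchSwinnertonDyer.BirchSwinnertonDyer.Theses.RamifiedHeegnerPair
import HarnessLib

set_option linter.dupNamespace false -- `…BirchSwinnertonDyer.BirchSwinnertonDyer…` is the cell's nested layout (D-0017)
set_option autoImplicit false

/-!
# Item 27199 `Gss2LowerPrintedInputsAtThree` of `RamifiedHeegnerPair` BY NAME, from eight print inputs
# (LADDER-BSD D-0154 (2), INPUTS-LIST-1 v2 TRANCHE ENTRY #1 «N6», by-name door for the RHP `L₁` child)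

Seat `bsd-inputs-honda-p1` (gen 6), `--supports` stmt-BirchSwinnertonDyer-27199. The route-free collapse term is
`Theorems.PublishedInputsAdditiveKolySlim.gss2LowerPrintedInputsAtThree_of_seven_of_kato` (module
`Theorems.PublishedInputsAdditiveKolyOfSeven`, item signature verbatim); this leaf file records it against the route
declaration `Theses.RamifiedHeegnerPair.Gss2LowerPrintedInputsAtThree` (PUB child of `Gss2LowerAtThreeRankOne`, support
r201; = the registered stub `stub_pub` of line `kolyvagin_split` v3, `Iff.rfl`) by `exact`. The RHP pen re-keying the
child imports the ROUTE-FREE module, not this leaf. THEOREMS ONLY; no definition, no named fact, no `sorry`.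

Honest framing: a CONDITIONAL door (eight named published facts as hypotheses: Gross–Zagier, Kolyvagin, Kolyvagin's
`Ш`-index bound, GZK over `ℚ`, the Modularity Theorem, Hoffstein–Luo, McCallum's certificate, Kato 2004 Thm. 14.5 (3) +
Prop. 14.16 (2)); item 27199 is a permanently-open published-input pack and is NOT closed by this; the crux
`Gss2LowerAtThreeRankOne` is not proved; no summit statement is proved; BSD is not proved by any of this.
References: [Kato2004Asterisque] Thm. 14.5 (3), Prop. 14.16 (2); [Darmon2004] Thms. 3.6–3.7; [DiamondShurman2005] Thm. 8.8.3.
-/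

namespace Summit.BirchSwinnertonDyer.BirchSwinnertonDyer.Theorems.PublishedInputsAdditiveKolySlim

open Literature.NumberTheory.EllipticCurves Literature.NumberTheory.EllipticCurves.ModularForms

/-- **`RamifiedHeegnerPair.Gss2LowerPrintedInputsAtThree` (item 27199, BY NAME) from eight displayed inputs** —
the seven of `publishedInputsAdditiveKoly_of_seven` and Kato's Tamagawa-exact rank-zero bound at an additive potentially
good prime (`hKato`); via `gss2LowerPrintedInputsAtThree_of_seven_of_kato`. Conditional; closes nothing; BSD is not proved
by this. [cite: Kato2004Asterisque, Thm. 14.5 (3) (p. 236), Prop. 14.16 (2) (p. 244)] [cite: Darmon2004, Thms. 3.6–3.7]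
[cite: DiamondShurman2005, Thm. 8.8.3 with Thm. 5.10.2] -/
theorem ramifiedHeegnerPair_gss2LowerPrintedInputsAtThree_of_seven_of_kato
    (hGZ : ∀ (N : ℕ) [NeZero N] (W : WeierstrassCurve ℚ) (K : Type) [Field K] [NumberField K], gross_zagier N W K)
    (hKo : ∀ (N : ℕ) [NeZero N] (W : WeierstrassCurve ℚ) (K : Type) [Field K] [NumberField K], kolyvagin N W K)
    (hKo90 : ∀ (N : ℕ) [NeZero N] (W : WeierstrassCurve ℚ) (K : Type) [Field K] [NumberField K],
      Kolyvagin1990_padicValNat_card_sha_le N W K)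
    (hGZK : rank_eq_analyticRank_of_analyticRank_le_one) (hnf : exists_isNewformOf)
    (hHL : HoffsteinLuo1997_exists_twist_L_one_ne_zero)
    (hMc : McCallum1991_pow_dvd_card_sha_primary_of_certificate)
    (hKato : Kato2004.rankZero_padicValNat_sha_add_padicValNat_tamagawa_le_of_additive_potGood_of_imageContainsSL2) :
    Summit.BirchSwinnertonDyer.BirchSwinnertonDyer.Theses.RamifiedHeegnerPair.Gss2LowerPrintedInputsAtThree := by
  unfold Summit.BirchSwinnertonDyer.BirchSwinnertonDyer.Theses.RamifiedHeegnerPair.Gss2LowerPrintedInputsAtThree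
  exact gss2LowerPrintedInputsAtThree_of_seven_of_kato hGZ hKo hKo90 hGZK hnf hHL hMc hKato

end Summit.BirchSwinnertonDyer.BirchSwinnertonDyer.Theorems.PublishedInputsAdditiveKolySlim
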